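import Summits.QuantumFields.YangMills.Theorems.BalabanUVNodesN06AtRecord11ObligationsS349
import Summits.QuantumFields.YangMills.Theorems.BalabanUVNodesN06AtRecord11ObligationsPins
import Summits.QuantumFields.YangMills.Theorems.BalabanUVNodesN06AtRecord11ObligationsPins2
import Literature.MathematicalPhysics.QuantumFieldTheory.Balaban1983to89.B9ResidualEntriesAtOne
import Literature.MathematicalPhysics.QuantumFieldTheory.Balaban1983to89.B9Cor35ComparisonsGAAtLetters
import Literature.MathematicalPhysics.QuantumFieldTheory.Balaban1983to89.B9Cor35ComparisonsGpCAtLetters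
import Literature.MathematicalPhysics.QuantumFieldTheory.Balaban1983to89.B9GeoLemma21KLevelV1
import Literature.MathematicalPhysics.QuantumFieldTheory.Balaban1983to89.B9Ineq347Reading

/-!
# BalabanUVNodes ∕ N06 ([B9], `Dag.B9_main`) — THE STAGE-11 CERTIFICATE KNIT AT def-Y's INSTANCE `ops := Node00.opsYOfLetters N θ M⋆ 𝔏 𝔈`:
# rows 1–8 DISCHARGED at the instance (n06-f, n06-g), the null readings off the summands by `rfl`, every other supplied row as in the chain of record

Track A of `YM-PLAN.md` (cell `pub-ymgap`, HUMAN RULING D-0062), node **N06** = [Balaban1985BackgroundPropagators] Thms 3.1–3.15; seat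
`pub-ymgap-dag-n06-d` gen 2 = dag-lead N06-ASSIGNMENT v1 (P3) «THE KNIT AT THE RECORD» — «the chain takes `ops := opsYOfLetters …` by unification» (P1 = node00-def-Y's
instance `Node00.OpsYOfLetters`, p464552).  Sibling of `BalabanUVNodesN06AtRecord11ObligationsBatch3` (generic `ops`, rows 4–8 through n06-g's `GAOfOps` pin): here the
operator layer IS def-Y's layer of letters, for EVERY covariant letter family `𝔏 : LettersY N θ M⋆` and expansion letters `𝔈 : ExpsY N θ M⋆`.

WHAT IS DISCHARGED AT THE INSTANCE (zero residual, for every `𝔏`, `𝔈`):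
* rows 1–3 `hGp_e hGp_h1 hC` — seat n06-f's `B9Cor35ComparisonsGpCAtLetters.hGp_e_opsYOfLetters` ∕ `hGp_h1_opsYOfLetters` ∕ `hC_opsYOfLetters` (p467330): the U = 1 comparison of
  G′(1)'s (3.42)∕(3.43) readings and of C(1)'s kernel against NODE 00's `GpU` ∕ `CinvU` (Cor. 3.5 p. 407 «for U = 1 these theorems are proved in [4]», at the readings).
* rows 4–8 `hGA_e hGA_h1 hGA_e4 hGA_h2 hGA_l2` — seat n06-g's `B9Cor35ComparisonsGAAtLetters.hGA_*_opsYOfLetters` (p468508), and the (3.47) null of G(1) on site arguments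
  (`hnullGA_opsYOfLetters`).
* the null readings of G′(1)'s (3.46)∕(3.47)∕(3.44)∕(3.45) quantities on BOND arguments (`rfl`: def-Y's `kernelFamilyS` reads `0` off the site summand).

WHAT STAYS DISPLAYED (exactly as in the chain of record, now ABOUT `𝔏`, `𝔈`): the 2 ORIGINAL operator-layer obligations `t312 t313` (rows 20–21); the suppliers' letters ∕ pins ∕
schemas ∕ readings of rows 11–18, 22–26 (the E-letter pins `E37 = W38OfOps …`, `E310 = W310OfOps …`, `EK39 = EK39OfOps …`, `PosDef = PosDefOfOps …` are met by the CHOICE of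
`𝔈`, whose fields are free); `hdict`; the co-readings and the (3.43)–(3.47) residuals of both halves of `hsum` (cell GAPS G-B9-07); (β)(γ) of row 22; the 24 Sect.-B steps of
row 13; the (3.42)-at-U=1 leaves + glob-readings + printed Lemma 2.1 behind rows 11–12's (3.47) sub-leaves.

WHAT THIS MODULE DOES (kernel bookkeeping; 0 `def`, 0 `sorry`, standard axioms; COUNT-NEUTRAL, `--supports` K1 `StabilityBAtRecordR11e`):
* `b9_main_of_up_view₁₁B10YZW_opsYOfLetters` — `Dag.B9_main (leavesP w P)` at every run `P` of a world `w` bound over the four-pin Stage-11 view of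
  `(θ, M⋆, opsYOfLetters N θ M⋆ 𝔏 𝔈, ζ, λ_W)`, from the displayed hypotheses above.

HONEST FRAMING.  The operator layer is def-Y's layer of LETTERS (total functions of U with U = 1 clauses) — NOT Bałaban's constructed G′(U), G(U), C(U) of Sect. 3 (def-Y v2);
every supplied row is supplied MODULO displayed hypothesis schemas of printed ∕ located shape; nothing of [B9] is proved for Bałaban's operators; k stays 0 ∕ 28 in the
referee's sense; N06 is NOT discharged.  One finite four-torus programme at fixed `ε` — NOT ℝ⁴, NOT OS, NOT a mass gap, NOT Clay.  No `def`.
-/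

noncomputable section

namespace Summit.QuantumFields.YangMills.BalabanUVNodes.N06AtOpsYOfLetters

open Literature.MathematicalPhysics.QuantumFieldTheory.Balaban1983to89
open Literature.MathematicalPhysics.QuantumFieldTheory.Balaban1983to89.T4Continuum (T4Family FiniteEpsData)
open Literature.MathematicalPhysics.QuantumFieldTheory.Balaban1983to89.DagBinding (WorldP leavesP B9LeafX)
open Literature.MathematicalPhysics.QuantumFieldTheory.Balaban1983to89.Node00
open Literature.MathematicalPhysics.QuantumFieldTheory.Balaban1983to89.B9PinMembersKLevelV1 (MemberY geo9Y bg9Y)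
open Literature.MathematicalPhysics.QuantumFieldTheory.Balaban1983to89.B9PinGeometryKLevelV1 (dOmegaY OmKY inΛY unitDistY InCubeY c35Y c35Y_pos)
open Literature.MathematicalPhysics.QuantumFieldTheory.Balaban1983to89.B7Prop2SpecialUnitary (specialUnitaryUnits)
open Literature.MathematicalPhysics.QuantumFieldTheory.Balaban1983to89.B9Thm37Whole (Ops Conv342 Sizes StaticOK Local342 Identities const37)
open Literature.MathematicalPhysics.QuantumFieldTheory.Balaban1983to89.B9Cor38Whole (WalkReading Locality W38OfOps)
open Literature.MathematicalPhysics.QuantumFieldTheory.Balaban1983to89.B9Thm37GlueCor36 (CoRealizes)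
open Literature.MathematicalPhysics.QuantumFieldTheory.Balaban1983to89.B6RandomWalk (Ineq261)
open Literature.MathematicalPhysics.QuantumFieldTheory.Balaban1983to89.B9Thm34Ext (toB6)
open Literature.MathematicalPhysics.QuantumFieldTheory.Balaban1983to89.B9Thm314 (Thm314LocalPrinted IneqSupF)
open Literature.MathematicalPhysics.QuantumFieldTheory.Balaban1983to89.B9SectBStepWhole
  (StepE StepL2n StepGlob StepH1 StepE4 StepH2 StepKer StepAnalytic)
open Literature.MathematicalPhysics.QuantumFieldTheory.Balaban1983to89.B9Ineq349Whole (Dict349)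
open Literature.MathematicalPhysics.QuantumFieldTheory.Balaban1983to89.B9Eq3132Whole (CTInputs InvNormalised WeightsTransfer)
open Literature.MathematicalPhysics.QuantumFieldTheory.Balaban1983to89.B9ResidualEntriesAtOne (AtOneL2On AtOneGlobOn AtOneH1On AtOneE4On AtOneH2On)
open Literature.MathematicalPhysics.QuantumFieldTheory.Balaban1983to89.B9Thm39Whole
  (Ops39 WalkReading39 EK39OfOps StaticOK39 Local348 Identities395 Small285 Factors389 Locality39 KerReads)
open Literature.MathematicalPhysics.QuantumFieldTheory.Balaban1983to89.B9Thm311Whole (Ops311 PosDefOfOps Inputs311)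
open Literature.MathematicalPhysics.QuantumFieldTheory.Balaban1983to89.B9Thm310Whole
  (Ops310 WalkReading310 Sizes310 StaticOK310 Locality310 Local342G Identities310 W310OfOps Conv3107)
open Literature.MathematicalPhysics.QuantumFieldTheory.Balaban1983to89.B9Thm315Whole (Ops315 Reads315 Static315 GivenBy3185OfOps HasRWExpCOfOps)
open Literature.MathematicalPhysics.QuantumFieldTheory.Balaban1983to89.B9Thm314Whole (DiffExpansionAllNorms RWSumFactorYieldsSupL2 RWSumFactorYieldsHolder)
open Literature.MathematicalPhysics.QuantumFieldTheory.Balaban1983to89.B9Ineq347Reading (GlobReading AtOneEOn Lemma21Above atOneGlobOn_of_atOneEOn)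
open Literature.MathematicalPhysics.QuantumFieldTheory.Balaban1983to89.B9GeoLemma21KLevelV1 (distOK_geo9Y levelGap_geo9Y_one rowSum261_geo9Y)
open Literature.MathematicalPhysics.QuantumFieldTheory.Balaban1983to89.B9GeoNormsKLevelModelSignsV1 (modelSignsOn_geo9K)
open Summit.QuantumFields.YangMills.BalabanUVNodes.N06AtRecord11ObligationsPins (t311_of_pin t310_of_pin hsumG_of_pin t314loc_of_leaves t315_of_pins)
open Literature.MathematicalPhysics.QuantumFieldTheory.Balaban1983to89.B9ResidualEntriesAtOne (hGp_of_blocksOn_of_null hGA_of_globOn_of_null)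
open Literature.MathematicalPhysics.QuantumFieldTheory.Balaban1983to89.B9Cor35ComparisonsGAAtLetters
  (hGA_e_opsYOfLetters hGA_h1_opsYOfLetters hGA_e4_opsYOfLetters hGA_h2_opsYOfLetters hGA_l2_opsYOfLetters hnullGA_opsYOfLetters)
open Literature.MathematicalPhysics.QuantumFieldTheory.Balaban1983to89.B9Cor35ComparisonsGpCAtLetters (hGp_e_opsYOfLetters hGp_h1_opsYOfLetters hC_opsYOfLetters)
open Summit.QuantumFields.YangMills.BalabanUVNodes.N06AtRecord11ObligationsPins2 (t39_of_pin hksum_of_pin s3132_of_inputs)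
open Summit.QuantumFields.YangMills.BalabanUVNodes.N06AtRecord11ObligationsS349 (b9_main_of_up_view₁₁B10YZW_of_obligations_W38T314SectBnHgEHS349supplied)
open scoped Matrix.Norms.L2Operator

variable {N : ℕ}

/-! ## THE KNIT AT ₁₁ AT def-Y's INSTANCE -/

section Pointed

variable [NeZero N] {F : T4Family}

/-- **THE STAGE-11 CERTIFICATE KNIT AT def-Y's INSTANCE** `ops := opsYOfLetters N θ M⋆ 𝔏 𝔈` (every `𝔏`, `𝔈`): `Dag.B9_main` at every run of a world bound over the
four-pin Stage-11 view, with rows 1–8 of the certificate DISCHARGED at the instance (n06-f's `hGp_e∕hGp_h1∕hC_opsYOfLetters`, n06-g's `hGA_*_opsYOfLetters`, the null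
readings off the summands by `rfl`), and — displayed, exactly as in the chain of record — `t312 t313`, the suppliers' letters ∕ pins ∕ schemas ∕ readings of rows 11–18 and
22–26, `hdict`, the co-readings and (3.43)–(3.47) residuals of `hsum`, (β)(γ), the 24 Sect.-B steps, the (3.42)-at-U=1 leaves + glob-readings + printed Lemma 2.1 of rows
11–12's (3.47) sub-leaves.  NOT a discharge of N06 (the layer is def-Y's layer of letters, not Bałaban's constructed operators).
[cite: Balaban1985BackgroundPropagators, Cor. 3.5 p.407, Thms 3.1–3.15 pp.397–432; Balaban1984PropagatorsII, Props. 2.2–2.6 pp.234–247, Lemma 2.1 pp.233–234] -/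
theorem b9_main_of_up_view₁₁B10YZW_opsYOfLetters (θ : Stage11Params F N) (hθ : θ.Admissible) (Mstar : ℕ)
    (𝔏 : LettersY N θ.toStage3Params Mstar) (𝔈 : ExpsY N θ.toStage3Params Mstar) (ζ : ResidZ F N) (lamW : ResidW F N) (w : WorldP)
    (hup : ∀ P, w.up P = upOfRecord₅C F N (θ.view₁₁B10YZW F N Mstar (opsYOfLetters N θ.toStage3Params Mstar 𝔏 𝔈) ζ lamW) P)
    -- in place of `hB`: n06-c's fourteen printed block-steps of Sect. B (§1)
    (hA : StepAnalytic (θ.d₆ + 1) c35Y geo9Y (bg9Y (Matrix (Fin N) (Fin N) ℂ) (specialUnitaryUnits (Fin N))) (fun x => ((opsYOfLetters N θ.toStage3Params Mstar 𝔏 𝔈) x).Gp) (fun x => ((opsYOfLetters N θ.toStage3Params Mstar 𝔏 𝔈) x).GA)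
      (fun x => ((opsYOfLetters N θ.toStage3Params Mstar 𝔏 𝔈) x).Cinv) (fun x => ((opsYOfLetters N θ.toStage3Params Mstar 𝔏 𝔈) x).IsAnalyticExt))
    (hEp : StepE (θ.d₆ + 1) c35Y geo9Y (bg9Y (Matrix (Fin N) (Fin N) ℂ) (specialUnitaryUnits (Fin N))) (fun x => ((opsYOfLetters N θ.toStage3Params Mstar 𝔏 𝔈) x).Gp) (fun x => ((opsYOfLetters N θ.toStage3Params Mstar 𝔏 𝔈) x).GA)
      (fun x => ((opsYOfLetters N θ.toStage3Params Mstar 𝔏 𝔈) x).Cinv) (fun x => ((opsYOfLetters N θ.toStage3Params Mstar 𝔏 𝔈) x).Gp))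
    (hLp : ∀ n : Fin 6, StepL2n (θ.d₆ + 1) c35Y geo9Y (bg9Y (Matrix (Fin N) (Fin N) ℂ) (specialUnitaryUnits (Fin N))) (fun x => ((opsYOfLetters N θ.toStage3Params Mstar 𝔏 𝔈) x).Gp) (fun x => ((opsYOfLetters N θ.toStage3Params Mstar 𝔏 𝔈) x).GA)
      (fun x => ((opsYOfLetters N θ.toStage3Params Mstar 𝔏 𝔈) x).Cinv) (fun x => ((opsYOfLetters N θ.toStage3Params Mstar 𝔏 𝔈) x).Gp) n)
    (hGlp : StepGlob (θ.d₆ + 1) c35Y geo9Y (bg9Y (Matrix (Fin N) (Fin N) ℂ) (specialUnitaryUnits (Fin N))) (fun x => ((opsYOfLetters N θ.toStage3Params Mstar 𝔏 𝔈) x).Gp) (fun x => ((opsYOfLetters N θ.toStage3Params Mstar 𝔏 𝔈) x).GA)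
      (fun x => ((opsYOfLetters N θ.toStage3Params Mstar 𝔏 𝔈) x).Cinv) (fun x => ((opsYOfLetters N θ.toStage3Params Mstar 𝔏 𝔈) x).Gp))
    (hH1p : StepH1 (θ.d₆ + 1) c35Y geo9Y (bg9Y (Matrix (Fin N) (Fin N) ℂ) (specialUnitaryUnits (Fin N))) (fun x => ((opsYOfLetters N θ.toStage3Params Mstar 𝔏 𝔈) x).Gp) (fun x => ((opsYOfLetters N θ.toStage3Params Mstar 𝔏 𝔈) x).GA)
      (fun x => ((opsYOfLetters N θ.toStage3Params Mstar 𝔏 𝔈) x).Cinv) (fun x => ((opsYOfLetters N θ.toStage3Params Mstar 𝔏 𝔈) x).Gp))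
    (hE4p : StepE4 (θ.d₆ + 1) c35Y geo9Y (bg9Y (Matrix (Fin N) (Fin N) ℂ) (specialUnitaryUnits (Fin N))) (fun x => ((opsYOfLetters N θ.toStage3Params Mstar 𝔏 𝔈) x).Gp) (fun x => ((opsYOfLetters N θ.toStage3Params Mstar 𝔏 𝔈) x).GA)
      (fun x => ((opsYOfLetters N θ.toStage3Params Mstar 𝔏 𝔈) x).Cinv) (fun x => ((opsYOfLetters N θ.toStage3Params Mstar 𝔏 𝔈) x).Gp))
    (hH2p : StepH2 (θ.d₆ + 1) c35Y geo9Y (bg9Y (Matrix (Fin N) (Fin N) ℂ) (specialUnitaryUnits (Fin N))) (fun x => ((opsYOfLetters N θ.toStage3Params Mstar 𝔏 𝔈) x).Gp) (fun x => ((opsYOfLetters N θ.toStage3Params Mstar 𝔏 𝔈) x).GA)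
      (fun x => ((opsYOfLetters N θ.toStage3Params Mstar 𝔏 𝔈) x).Cinv) (fun x => ((opsYOfLetters N θ.toStage3Params Mstar 𝔏 𝔈) x).Gp))
    (hK : StepKer (θ.d₆ + 1) c35Y geo9Y (bg9Y (Matrix (Fin N) (Fin N) ℂ) (specialUnitaryUnits (Fin N))) (fun x => ((opsYOfLetters N θ.toStage3Params Mstar 𝔏 𝔈) x).Gp) (fun x => ((opsYOfLetters N θ.toStage3Params Mstar 𝔏 𝔈) x).GA)
      (fun x => ((opsYOfLetters N θ.toStage3Params Mstar 𝔏 𝔈) x).Cinv) (fun x => ((opsYOfLetters N θ.toStage3Params Mstar 𝔏 𝔈) x).Cinv))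
    (hEa : StepE (θ.d₆ + 1) c35Y geo9Y (bg9Y (Matrix (Fin N) (Fin N) ℂ) (specialUnitaryUnits (Fin N))) (fun x => ((opsYOfLetters N θ.toStage3Params Mstar 𝔏 𝔈) x).Gp) (fun x => ((opsYOfLetters N θ.toStage3Params Mstar 𝔏 𝔈) x).GA)
      (fun x => ((opsYOfLetters N θ.toStage3Params Mstar 𝔏 𝔈) x).Cinv) (fun x => ((opsYOfLetters N θ.toStage3Params Mstar 𝔏 𝔈) x).GA))
    (hLa : ∀ n : Fin 6, StepL2n (θ.d₆ + 1) c35Y geo9Y (bg9Y (Matrix (Fin N) (Fin N) ℂ) (specialUnitaryUnits (Fin N))) (fun x => ((opsYOfLetters N θ.toStage3Params Mstar 𝔏 𝔈) x).Gp) (fun x => ((opsYOfLetters N θ.toStage3Params Mstar 𝔏 𝔈) x).GA)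
      (fun x => ((opsYOfLetters N θ.toStage3Params Mstar 𝔏 𝔈) x).Cinv) (fun x => ((opsYOfLetters N θ.toStage3Params Mstar 𝔏 𝔈) x).GA) n)
    (hGla : StepGlob (θ.d₆ + 1) c35Y geo9Y (bg9Y (Matrix (Fin N) (Fin N) ℂ) (specialUnitaryUnits (Fin N))) (fun x => ((opsYOfLetters N θ.toStage3Params Mstar 𝔏 𝔈) x).Gp) (fun x => ((opsYOfLetters N θ.toStage3Params Mstar 𝔏 𝔈) x).GA)
      (fun x => ((opsYOfLetters N θ.toStage3Params Mstar 𝔏 𝔈) x).Cinv) (fun x => ((opsYOfLetters N θ.toStage3Params Mstar 𝔏 𝔈) x).GA))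
    (hH1a : StepH1 (θ.d₆ + 1) c35Y geo9Y (bg9Y (Matrix (Fin N) (Fin N) ℂ) (specialUnitaryUnits (Fin N))) (fun x => ((opsYOfLetters N θ.toStage3Params Mstar 𝔏 𝔈) x).Gp) (fun x => ((opsYOfLetters N θ.toStage3Params Mstar 𝔏 𝔈) x).GA)
      (fun x => ((opsYOfLetters N θ.toStage3Params Mstar 𝔏 𝔈) x).Cinv) (fun x => ((opsYOfLetters N θ.toStage3Params Mstar 𝔏 𝔈) x).GA))
    (hE4a : StepE4 (θ.d₆ + 1) c35Y geo9Y (bg9Y (Matrix (Fin N) (Fin N) ℂ) (specialUnitaryUnits (Fin N))) (fun x => ((opsYOfLetters N θ.toStage3Params Mstar 𝔏 𝔈) x).Gp) (fun x => ((opsYOfLetters N θ.toStage3Params Mstar 𝔏 𝔈) x).GA)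
      (fun x => ((opsYOfLetters N θ.toStage3Params Mstar 𝔏 𝔈) x).Cinv) (fun x => ((opsYOfLetters N θ.toStage3Params Mstar 𝔏 𝔈) x).GA))
    (hH2a : StepH2 (θ.d₆ + 1) c35Y geo9Y (bg9Y (Matrix (Fin N) (Fin N) ℂ) (specialUnitaryUnits (Fin N))) (fun x => ((opsYOfLetters N θ.toStage3Params Mstar 𝔏 𝔈) x).Gp) (fun x => ((opsYOfLetters N θ.toStage3Params Mstar 𝔏 𝔈) x).GA)
      (fun x => ((opsYOfLetters N θ.toStage3Params Mstar 𝔏 𝔈) x).Cinv) (fun x => ((opsYOfLetters N θ.toStage3Params Mstar 𝔏 𝔈) x).GA))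
    -- in place of `t37`, `c38`, `hsum`: as in sequel II
    [∀ x : MemberY θ.d₆ θ.ℓ₆ θ.hd' θ.hL' θ.b₀ θ.b₁ Mstar, Fintype (geo9Y x).Site]
    [∀ x : MemberY θ.d₆ θ.ℓ₆ θ.hd' θ.hL' θ.b₀ θ.b₁ Mstar, DecidableEq (geo9Y x).Site]
    {X Y ι : MemberY θ.d₆ θ.ℓ₆ θ.hd' θ.hL' θ.b₀ θ.b₁ Mstar → Type}
    [∀ x, Fintype (X x)] [∀ x, DecidableEq (X x)] [∀ x, Fintype (Y x)] [∀ x, DecidableEq (Y x)] [∀ x, Fintype (ι x)]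
    -- rows 11–12 (seat n06-h): G′(1)'s per-block leaves ON site arguments (the null readings off the summands hold by `rfl` at the instance)
    (hGpL2 : AtOneL2On geo9Y (bg9Y (Matrix (Fin N) (Fin N) ℂ) (specialUnitaryUnits (Fin N))) (fun x => ((opsYOfLetters N θ.toStage3Params Mstar 𝔏 𝔈) x).Gp) (fun _ lam => ¬ (lam.isRight = true)))
    (hGpH1 : AtOneH1On geo9Y (bg9Y (Matrix (Fin N) (Fin N) ℂ) (specialUnitaryUnits (Fin N))) (fun x => ((opsYOfLetters N θ.toStage3Params Mstar 𝔏 𝔈) x).Gp) (fun _ lam => ¬ (lam.isRight = true)))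
    (hGpE4 : AtOneE4On geo9Y (bg9Y (Matrix (Fin N) (Fin N) ℂ) (specialUnitaryUnits (Fin N))) (fun x => ((opsYOfLetters N θ.toStage3Params Mstar 𝔏 𝔈) x).Gp) (fun _ lam => ¬ (lam.isRight = true)))
    (hGpH2 : AtOneH2On geo9Y (bg9Y (Matrix (Fin N) (Fin N) ℂ) (specialUnitaryUnits (Fin N))) (fun x => ((opsYOfLetters N θ.toStage3Params Mstar 𝔏 𝔈) x).Gp) (fun _ lam => ¬ (lam.isRight = true)))
    -- the two (3.47) sub-leaves at U = 1 (seat n06-h's `B9Ineq347Reading`): (3.42) leaves ON the summand, glob-readings, [4] Lemma 2.1 in printed form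
    {res resA : ∀ x : MemberY θ.d₆ θ.ℓ₆ θ.hd' θ.hL' θ.b₀ θ.b₁ Mstar, (geo9Y x).Site → (geo9Y x).Loc → (geo9Y x).Loc}
    (hRGp : ∀ x : MemberY θ.d₆ θ.ℓ₆ θ.hd' θ.hL' θ.b₀ θ.b₁ Mstar, GlobReading ((opsYOfLetters N θ.toStage3Params Mstar 𝔏 𝔈) x).Gp (fun lam => ¬ (lam.isRight = true)) (bg9Y (Matrix (Fin N) (Fin N) ℂ) (specialUnitaryUnits (Fin N)) x).one (res x))
    (hRGA : ∀ x : MemberY θ.d₆ θ.ℓ₆ θ.hd' θ.hL' θ.b₀ θ.b₁ Mstar, GlobReading ((opsYOfLetters N θ.toStage3Params Mstar 𝔏 𝔈) x).GA (fun lam => lam.isRight = true) (bg9Y (Matrix (Fin N) (Fin N) ℂ) (specialUnitaryUnits (Fin N)) x).one (resA x))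
    {d21 : ℕ} {R21 : MemberY θ.d₆ θ.ℓ₆ θ.hd' θ.hL' θ.b₀ θ.b₁ Mstar → ℝ} {H21 : MemberY θ.d₆ θ.ℓ₆ θ.hd' θ.hL' θ.b₀ θ.b₁ Mstar → Prop} {α21 : ℝ}
    (hL21 : ∀ δ' : ℝ, 0 < δ' → ∃ ML' : ℝ,
      Lemma21Above d21 (geo9Y (d := θ.d₆) (ℓ := θ.ℓ₆) (hd := θ.hd') (hL := θ.hL') (b₀ := θ.b₀) (b₁ := θ.b₁) (Mstar := Mstar)) R21 H21 δ' α21 ML')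
    (hEGp : AtOneEOn geo9Y (bg9Y (Matrix (Fin N) (Fin N) ℂ) (specialUnitaryUnits (Fin N))) (fun x => ((opsYOfLetters N θ.toStage3Params Mstar 𝔏 𝔈) x).Gp) (fun _ lam => ¬ (lam.isRight = true)))
    (hEGA : AtOneEOn geo9Y (bg9Y (Matrix (Fin N) (Fin N) ℂ) (specialUnitaryUnits (Fin N))) (fun x => ((opsYOfLetters N θ.toStage3Params Mstar 𝔏 𝔈) x).GA) (fun _ lam => lam.isRight = true))
    -- rows 15–16 (seat n06-j): the (3.98) expansion pinned to the letters of Q′G′²Q′*, its schemas, the kernel reading of (Q′G′²Q′*)⁻¹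
    {ι39 κ39 : MemberY θ.d₆ θ.ℓ₆ θ.hd' θ.hL' θ.b₀ θ.b₁ Mstar → Type} [∀ x, Fintype (ι39 x)]
    (𝔬39 : ∀ x : MemberY θ.d₆ θ.ℓ₆ θ.hd' θ.hL' θ.b₀ θ.b₁ Mstar, Ops39 (geo9Y x) (bg9Y (Matrix (Fin N) (Fin N) ℂ) (specialUnitaryUnits (Fin N)) x) (ι39 x) (κ39 x))
    (rd39 : ∀ x : MemberY θ.d₆ θ.ℓ₆ θ.hd' θ.hL' θ.b₀ θ.b₁ Mstar, WalkReading39 (bg9Y (Matrix (Fin N) (Fin N) ℂ) (specialUnitaryUnits (Fin N)) x) (ι39 x) (κ39 x))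
    (R39 : MemberY θ.d₆ θ.ℓ₆ θ.hd' θ.hL' θ.b₀ θ.b₁ Mstar → ℝ) (H39 : MemberY θ.d₆ θ.ℓ₆ θ.hd' θ.hL' θ.b₀ θ.b₁ Mstar → Prop) (α39 α' r39 δ39 θ39 B39 N39 a39 M39 ML39 : ℝ)
    (h39α : 0 ≤ α39) (h39α1 : α39 < 1) (hα' : α' ≤ 1) (hr39 : 0 ≤ r39) (hrδ39 : r39 ≤ δ39) (hδ39 : 0 < δ39) (hθ39 : 0 ≤ θ39)
    (hB39 : 0 < B39) (hN39 : 0 ≤ N39) (ha39 : 0 < a39) (hM39 : 0 < M39)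
    (hst39 : ∀ x, StaticOK39 (𝔬39 x) N39) (hloc39 : ∀ x, Locality39 (𝔬39 x) (rd39 x))
    (h261_39 : ∀ x : MemberY θ.d₆ θ.ℓ₆ θ.hd' θ.hL' θ.b₀ θ.b₁ Mstar, ML39 ≤ (geo9Y x).M →
      Ineq261 (θ.d₆ + 1) (toB6 (geo9Y x) (R39 x) (H39 x)) δ39 α39 ∧ Ineq261 (θ.d₆ + 1) (toB6 (geo9Y x) (R39 x) (H39 x)) r39 α')
    (h39 : ∀ x : MemberY θ.d₆ θ.ℓ₆ θ.hd' θ.hL' θ.b₀ θ.b₁ Mstar, M39 ≤ (geo9Y x).M → ∀ α₀ : ℝ, 0 < α₀ → c35Y * (geo9Y x).M * α₀ ≤ a39 →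
      ∀ U : (bg9Y (Matrix (Fin N) (Fin N) ℂ) (specialUnitaryUnits (Fin N)) x).Cfg, (bg9Y (Matrix (Fin N) (Fin N) ℂ) (specialUnitaryUnits (Fin N)) x).Reg335 c35Y α₀ U →
        Local348 (𝔬39 x) (θ.d₆ + 1) B39 δ39 U ∧ Identities395 (𝔬39 x) U ∧ Small285 (𝔬39 x) (θ.d₆ + 1) θ39 r39 U ∧
          Factors389 (𝔬39 x) (θ.d₆ + 1) θ39 δ39 U)
    (hEK39 : ∀ x : MemberY θ.d₆ θ.ℓ₆ θ.hd' θ.hL' θ.b₀ θ.b₁ Mstar, ((opsYOfLetters N θ.toStage3Params Mstar 𝔏 𝔈) x).EK39 = EK39OfOps (𝔬39 x) (rd39 x) (θ.d₆ + 1) (2 * (N39 * B39) * B6.c1 (θ.d₆ + 1) r39 α') ((1 - α') * r39))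
    (hB₁39 : 0 < 2 * (N39 * B39) * B6.c1 (θ.d₆ + 1) r39 α') (hδ₁39 : 0 < (1 - α') * r39)
    (hrdC : ∀ x : MemberY θ.d₆ θ.ℓ₆ θ.hd' θ.hL' θ.b₀ θ.b₁ Mstar, KerReads (𝔬39 x) ((opsYOfLetters N θ.toStage3Params Mstar 𝔏 𝔈) x).Cinv (θ.d₆ + 1))
    -- row 26 (seat n06-i): Combes–Thomas inputs, normalisation readings of (QGQ*)⁻¹ ∕ (QG₁Q*)⁻¹, weights transfer
    {S32 S32₁ : ∀ x : MemberY θ.d₆ θ.ℓ₆ θ.hd' θ.hL' θ.b₀ θ.b₁ Mstar, (bg9Y (Matrix (Fin N) (Fin N) ℂ) (specialUnitaryUnits (Fin N)) x).Cfg → Matrix (geo9Y x).Site (geo9Y x).Site ℝ}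
    {w32 w32₁ : ∀ x : MemberY θ.d₆ θ.ℓ₆ θ.hd' θ.hL' θ.b₀ θ.b₁ Mstar, (geo9Y x).Site → ℝ}
    (hCT : CTInputs c35Y geo9Y (bg9Y (Matrix (Fin N) (Fin N) ℂ) (specialUnitaryUnits (Fin N))) S32) (hCT₁ : CTInputs c35Y geo9Y (bg9Y (Matrix (Fin N) (Fin N) ℂ) (specialUnitaryUnits (Fin N))) S32₁)
    (hN32 : ∀ x : MemberY θ.d₆ θ.ℓ₆ θ.hd' θ.hL' θ.b₀ θ.b₁ Mstar, InvNormalised ((opsYOfLetters N θ.toStage3Params Mstar 𝔏 𝔈) x).QGQinv (S32 x) (w32 x)) (hN32₁ : ∀ x : MemberY θ.d₆ θ.ℓ₆ θ.hd' θ.hL' θ.b₀ θ.b₁ Mstar, InvNormalised ((opsYOfLetters N θ.toStage3Params Mstar 𝔏 𝔈) x).QG1Qinv (S32₁ x) (w32₁ x))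
    {A32 : ℝ} (hA32 : 0 < A32)
    (hwt : ∀ ε : ℝ, 0 < ε → ∃ Mw : ℝ, ∀ x : MemberY θ.d₆ θ.ℓ₆ θ.hd' θ.hL' θ.b₀ θ.b₁ Mstar, Mw ≤ (geo9Y x).M →
      WeightsTransfer (geo9Y x) (θ.d₆ + 1) (w32 x) ε A32 ∧ WeightsTransfer (geo9Y x) (θ.d₆ + 1) (w32₁ x) ε A32)
    (𝔬 : ∀ x, Ops (geo9Y x) (bg9Y (Matrix (Fin N) (Fin N) ℂ) (specialUnitaryUnits (Fin N)) x) (X x) (Y x) (ι x))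
    (rd : ∀ x, WalkReading (geo9Y x) (bg9Y (Matrix (Fin N) (Fin N) ℂ) (specialUnitaryUnits (Fin N)) x) (X x) (ι x))
    (R : MemberY θ.d₆ θ.ℓ₆ θ.hd' θ.hL' θ.b₀ θ.b₁ Mstar → ℝ) (H : MemberY θ.d₆ θ.ℓ₆ θ.hd' θ.hL' θ.b₀ θ.b₁ Mstar → Prop)
    (κ : MemberY θ.d₆ θ.ℓ₆ θ.hd' θ.hL' θ.b₀ θ.b₁ Mstar → Sizes) (d : ℕ) (α ρ Nc N' Cℓ K θ₀ B₀ δ₀ a₁ M₁ ML : ℝ)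
    (hα : 0 ≤ α) (hα2 : α ≤ 1 / 2) (hN : 0 ≤ Nc) (hN' : 0 ≤ N') (hCℓ : 1 ≤ Cℓ) (hK0 : 0 ≤ K) (hθ₀ : 0 ≤ θ₀) (hB₀ : 0 < B₀) (hδ₀ : 0 < δ₀)
    (ha₁ : 0 < a₁) (hM₁ : 0 < M₁)
    (hst : ∀ x, StaticOK (𝔬 x) ρ Nc N' Cℓ (κ x)) (hκ : ∀ x, (κ x).Bounded K θ₀ Cℓ (geo9Y x).M)
    (hrd : ∀ x, (rd x).OK (𝔬 x).blk) (hloc : ∀ x, Locality (𝔬 x) (rd x))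
    (h261 : ∀ x, ML ≤ (geo9Y x).M → Ineq261 d (toB6 (geo9Y x) (R x) (H x)) δ₀ α)
    (h36 : ∀ x, M₁ ≤ (geo9Y x).M → ∀ α₀ : ℝ, 0 < α₀ → c35Y * (geo9Y x).M * α₀ ≤ a₁ →
      ∀ U : (bg9Y (Matrix (Fin N) (Fin N) ℂ) (specialUnitaryUnits (Fin N)) x).Cfg,
        (bg9Y (Matrix (Fin N) (Fin N) ℂ) (specialUnitaryUnits (Fin N)) x).Reg335 c35Y α₀ U →
          Local342 (𝔬 x) (R x) (H x) B₀ δ₀ U ∧ Identities (𝔬 x) (R x) (H x) U)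
    (hE38 : ∀ x, ((opsYOfLetters N θ.toStage3Params Mstar 𝔏 𝔈) x).E37 = W38OfOps (𝔬 x) (rd x) (R x) (H x) (const37 d δ₀ α ρ B₀ Nc N' Cℓ K) ((1 - 2 * α) * δ₀))
    (evY : ∀ x : MemberY θ.d₆ θ.ℓ₆ θ.hd' θ.hL' θ.b₀ θ.b₁ Mstar, (geo9Y x).Loc → Y x → ℝ)
    (hco0 : ∀ x U, CoRealizes ((opsYOfLetters N θ.toStage3Params Mstar 𝔏 𝔈) x).Gp 0 U (𝔬 x).blk (𝔬 x).blk (rd x).ev ((𝔬 x).Gp U))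
    (hco1 : ∀ x U, CoRealizes ((opsYOfLetters N θ.toStage3Params Mstar 𝔏 𝔈) x).Gp 1 U (𝔬 x).blkY (𝔬 x).blk (rd x).ev ((𝔬 x).D U ∘ₗ (𝔬 x).Gp U))
    (hco2 : ∀ x U, CoRealizes ((opsYOfLetters N θ.toStage3Params Mstar 𝔏 𝔈) x).Gp 2 U (𝔬 x).blk (𝔬 x).blkY (evY x) ((𝔬 x).Gp U ∘ₗ (𝔬 x).Dstar U))
    (hco3 : ∀ x U, CoRealizes ((opsYOfLetters N θ.toStage3Params Mstar 𝔏 𝔈) x).Gp 3 U (𝔬 x).blk (𝔬 x).blk (rd x).ev ((𝔬 x).Lap U ∘ₗ (𝔬 x).Gp U))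
    {B₁ δ₁ : ℝ} (hB₁ : 0 < B₁) (hδ₁ : 0 < δ₁) (hCB : const37 d δ₀ α ρ B₀ Nc N' Cℓ K ≤ B₁) (hδ₁le : δ₁ ≤ (1 - 2 * α) * δ₀)
    {Bβ Bε : ℝ → ℝ} {Bεβ : ℝ → ℝ → ℝ}
    (hrest : ∀ (x : MemberY θ.d₆ θ.ℓ₆ θ.hd' θ.hL' θ.b₀ θ.b₁ Mstar) (U : (bg9Y (Matrix (Fin N) (Fin N) ℂ) (specialUnitaryUnits (Fin N)) x).Cfg),
      (((opsYOfLetters N θ.toStage3Params Mstar 𝔏 𝔈) x).E37).Converges U →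
        (∀ (n : Fin 6) (lam : (geo9Y x).Loc) (h : (geo9Y x).Cut) (y y' : (geo9Y x).Site), (geo9Y x).cutIn h y → (geo9Y x).suppIn lam y' →
            ((opsYOfLetters N θ.toStage3Params Mstar 𝔏 𝔈) x).Gp.l2 n U lam h ≤ B₁ * B9.pref6 ((geo9Y x).len y) n * (geo9Y x).cutSup h * Real.exp (-(δ₁ * (geo9Y x).dist y y')) * (geo9Y x).l2Norm lam) ∧
        (∀ (n : Fin 4) (lam : (geo9Y x).Loc) (γ : ℝ), -4 ≤ γ → γ ≤ 4 → ((opsYOfLetters N θ.toStage3Params Mstar 𝔏 𝔈) x).Gp.glob n U lam γ ≤ B₁ * (geo9Y x).wNorm γ lam) ∧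
        B9.Ineq343_345 ((opsYOfLetters N θ.toStage3Params Mstar 𝔏 𝔈) x).Gp Bβ Bε Bεβ δ₁ U)
    -- row 17 (seat n06-j): the letters of Theorem 3.11, the printed proof's inputs under the provisos, the literal pin of `PosDef`
    {E7 F7 W7 : MemberY θ.d₆ θ.ℓ₆ θ.hd' θ.hL' θ.b₀ θ.b₁ Mstar → Type} [∀ x, NormedAddCommGroup (E7 x)] [∀ x, InnerProductSpace ℝ (E7 x)] [∀ x, NormedAddCommGroup (F7 x)]
    [∀ x, InnerProductSpace ℝ (F7 x)] [∀ x, NormedAddCommGroup (W7 x)] [∀ x, InnerProductSpace ℝ (W7 x)] [∀ x, FiniteDimensional ℝ (W7 x)]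
    (𝔬311 : ∀ x : MemberY θ.d₆ θ.ℓ₆ θ.hd' θ.hL' θ.b₀ θ.b₁ Mstar, Ops311 (bg9Y (Matrix (Fin N) (Fin N) ℂ) (specialUnitaryUnits (Fin N)) x) (E7 x) (F7 x) (W7 x)) (θ311 a311 M311 : ℝ) (ha311 : 0 < a311) (hM311 : 0 < M311)
    (h311 : ∀ x : MemberY θ.d₆ θ.ℓ₆ θ.hd' θ.hL' θ.b₀ θ.b₁ Mstar, M311 ≤ (geo9Y x).M → ∀ α₀ : ℝ, 0 < α₀ → (geo9Y x).M * α₀ ≤ a311 →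
      ∀ U : (bg9Y (Matrix (Fin N) (Fin N) ℂ) (specialUnitaryUnits (Fin N)) x).Cfg, (bg9Y (Matrix (Fin N) (Fin N) ℂ) (specialUnitaryUnits (Fin N)) x).Reg335 c35Y α₀ U → Inputs311 (𝔬311 x) θ311 (geo9Y x).M U)
    (hPD : ∀ x : MemberY θ.d₆ θ.ℓ₆ θ.hd' θ.hL' θ.b₀ θ.b₁ Mstar, ((opsYOfLetters N θ.toStage3Params Mstar 𝔏 𝔈) x).PosDef = PosDefOfOps (𝔬311 x))
    -- row 18 (seat n06-k): the letters of Theorem 3.10, its schemas, the literal pin of `E310`; the co-readings of `GA` by those letters; the G-half residual of `hsum`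
    {X3 Y3 ι3 A3 : MemberY θ.d₆ θ.ℓ₆ θ.hd' θ.hL' θ.b₀ θ.b₁ Mstar → Type} [∀ x, Fintype (X3 x)] [∀ x, DecidableEq (X3 x)] [∀ x, Fintype (Y3 x)] [∀ x, DecidableEq (Y3 x)]
    [∀ x, Fintype (ι3 x)] [∀ x, Fintype (A3 x)]
    (𝔬310 : ∀ x : MemberY θ.d₆ θ.ℓ₆ θ.hd' θ.hL' θ.b₀ θ.b₁ Mstar, Ops310 (geo9Y x) (bg9Y (Matrix (Fin N) (Fin N) ℂ) (specialUnitaryUnits (Fin N)) x) (X3 x) (Y3 x) (ι3 x) (A3 x))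
    (rd310 : ∀ x : MemberY θ.d₆ θ.ℓ₆ θ.hd' θ.hL' θ.b₀ θ.b₁ Mstar, WalkReading310 (geo9Y x) (bg9Y (Matrix (Fin N) (Fin N) ℂ) (specialUnitaryUnits (Fin N)) x) (X3 x) (ι3 x) (A3 x))
    (R310 : MemberY θ.d₆ θ.ℓ₆ θ.hd' θ.hL' θ.b₀ θ.b₁ Mstar → ℝ) (H310 : MemberY θ.d₆ θ.ℓ₆ θ.hd' θ.hL' θ.b₀ θ.b₁ Mstar → Prop) (κ310 : MemberY θ.d₆ θ.ℓ₆ θ.hd' θ.hL' θ.b₀ θ.b₁ Mstar → Sizes310)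
    (d3 : ℕ) (α3 ρ3 N3 N3' NF3 Cℓ3 K3 θ3 B3 δ3 a3 M3 ML3 : ℝ)
    (hα3 : 0 ≤ α3) (hα3' : α3 ≤ 1 / 2) (hN3 : 0 ≤ N3) (hN3' : 0 ≤ N3') (hNF3 : 0 ≤ NF3) (hCℓ3 : 1 ≤ Cℓ3) (hK3 : 0 ≤ K3) (hθ3 : 0 ≤ θ3) (hB3 : 0 < B3)
    (hδ3 : 0 < δ3) (ha3 : 0 < a3) (hM3 : 0 < M3)
    (hst3 : ∀ x, StaticOK310 (𝔬310 x) ρ3 N3 N3' NF3 Cℓ3 (κ310 x)) (hκ3 : ∀ x, (κ310 x).Bounded K3)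
    (hrd3 : ∀ x, (rd310 x).OK (𝔬310 x).blk) (hloc3 : ∀ x, Locality310 (𝔬310 x) (rd310 x))
    (h261_3 : ∀ x : MemberY θ.d₆ θ.ℓ₆ θ.hd' θ.hL' θ.b₀ θ.b₁ Mstar, ML3 ≤ (geo9Y x).M → Ineq261 d3 (toB6 (geo9Y x) (R310 x) (H310 x)) δ3 α3)
    (h36_3 : ∀ x : MemberY θ.d₆ θ.ℓ₆ θ.hd' θ.hL' θ.b₀ θ.b₁ Mstar, M3 ≤ (geo9Y x).M → ∀ α₀ : ℝ, 0 < α₀ → c35Y * (geo9Y x).M * α₀ ≤ a3 →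
      ∀ U : (bg9Y (Matrix (Fin N) (Fin N) ℂ) (specialUnitaryUnits (Fin N)) x).Cfg, (bg9Y (Matrix (Fin N) (Fin N) ℂ) (specialUnitaryUnits (Fin N)) x).Reg335 c35Y α₀ U →
        Local342G (𝔬310 x) (R310 x) (H310 x) B3 δ3 U ∧ B9Thm310Whole.Factors389 (𝔬310 x) (R310 x) (H310 x) θ3 δ3 U ∧
          Identities310 (𝔬310 x) (R310 x) (H310 x) U)
    (hE310 : ∀ x : MemberY θ.d₆ θ.ℓ₆ θ.hd' θ.hL' θ.b₀ θ.b₁ Mstar, ((opsYOfLetters N θ.toStage3Params Mstar 𝔏 𝔈) x).E310 = W310OfOps (𝔬310 x) (rd310 x)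
      (Conv3107 (𝔬310 x) (R310 x) (H310 x) (const37 d3 δ3 α3 ρ3 B3 N3 N3' Cℓ3 K3) ((1 - 2 * α3) * δ3)))
    (ev3 : ∀ x : MemberY θ.d₆ θ.ℓ₆ θ.hd' θ.hL' θ.b₀ θ.b₁ Mstar, (geo9Y x).Loc → X3 x → ℝ) (evY3 : ∀ x : MemberY θ.d₆ θ.ℓ₆ θ.hd' θ.hL' θ.b₀ θ.b₁ Mstar, (geo9Y x).Loc → Y3 x → ℝ)
    (hcoA0 : ∀ x U, CoRealizes ((opsYOfLetters N θ.toStage3Params Mstar 𝔏 𝔈) x).GA 0 U (𝔬310 x).blk (𝔬310 x).blk (ev3 x) ((𝔬310 x).G U))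
    (hcoA1 : ∀ x U, CoRealizes ((opsYOfLetters N θ.toStage3Params Mstar 𝔏 𝔈) x).GA 1 U (𝔬310 x).blkY (𝔬310 x).blk (ev3 x) ((𝔬310 x).D U ∘ₗ (𝔬310 x).G U))
    (hcoA2 : ∀ x U, CoRealizes ((opsYOfLetters N θ.toStage3Params Mstar 𝔏 𝔈) x).GA 2 U (𝔬310 x).blk (𝔬310 x).blkY (evY3 x) ((𝔬310 x).G U ∘ₗ (𝔬310 x).Dstar U))
    (hcoA3 : ∀ x U, CoRealizes ((opsYOfLetters N θ.toStage3Params Mstar 𝔏 𝔈) x).GA 3 U (𝔬310 x).blk (𝔬310 x).blk (ev3 x) ((𝔬310 x).Lap U ∘ₗ (𝔬310 x).G U))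
    (hCB3 : const37 d3 δ3 α3 ρ3 B3 N3 N3' Cℓ3 K3 ≤ B₁) (hδ₁le3 : δ₁ ≤ (1 - 2 * α3) * δ3)
    (hrestA : ∀ (x : MemberY θ.d₆ θ.ℓ₆ θ.hd' θ.hL' θ.b₀ θ.b₁ Mstar) (U : (bg9Y (Matrix (Fin N) (Fin N) ℂ) (specialUnitaryUnits (Fin N)) x).Cfg),
      (((opsYOfLetters N θ.toStage3Params Mstar 𝔏 𝔈) x).E310).Converges U →
        (∀ (n : Fin 6) (lam : (geo9Y x).Loc) (h : (geo9Y x).Cut) (y y' : (geo9Y x).Site), (geo9Y x).cutIn h y → (geo9Y x).suppIn lam y' →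
            ((opsYOfLetters N θ.toStage3Params Mstar 𝔏 𝔈) x).GA.l2 n U lam h ≤ B₁ * B9.pref6 ((geo9Y x).len y) n * (geo9Y x).cutSup h * Real.exp (-(δ₁ * (geo9Y x).dist y y')) * (geo9Y x).l2Norm lam) ∧
        (∀ (n : Fin 4) (lam : (geo9Y x).Loc) (γ : ℝ), -4 ≤ γ → γ ≤ 4 → ((opsYOfLetters N θ.toStage3Params Mstar 𝔏 𝔈) x).GA.glob n U lam γ ≤ B₁ * (geo9Y x).wNorm γ lam) ∧
        B9.Ineq343_345 ((opsYOfLetters N θ.toStage3Params Mstar 𝔏 𝔈) x).GA Bβ Bε Bεβ δ₁ U)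
    -- row 23 (seat n06-m): the leaves of Theorem 3.14's printed proof at the local reading, the M-uniform diameter bound (flag T314 (ii))
    {Ediff : ∀ x : MemberY θ.d₆ θ.ℓ₆ θ.hd' θ.hL' θ.b₀ θ.b₁ Mstar, B9.RWExpansion (geo9Y x) (bg9Y (Matrix (Fin N) (Fin N) ℂ) (specialUnitaryUnits (Fin N)) x)}
    {termK : ∀ x : MemberY θ.d₆ θ.ℓ₆ θ.hd' θ.hL' θ.b₀ θ.b₁ Mstar, (Ediff x).Walk → B9.KernelFamily (geo9Y x) (bg9Y (Matrix (Fin N) (Fin N) ℂ) (specialUnitaryUnits (Fin N)) x)}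
    (D314 : ∀ x : MemberY θ.d₆ θ.ℓ₆ θ.hd' θ.hL' θ.b₀ θ.b₁ Mstar, B9Thm314.LocData (geo9Y x) (bg9Y (Matrix (Fin N) (Fin N) ℂ) (specialUnitaryUnits (Fin N)) x) (Ediff x)) (L314 : ∀ x, (D314 x).Laws (dOmegaY x)) (r314 : ℝ)
    (hr314 : ∀ x, (D314 x).diam ≤ r314)
    (hA314 : DiffExpansionAllNorms c35Y geo9Y (bg9Y (Matrix (Fin N) (Fin N) ℂ) (specialUnitaryUnits (Fin N))) Ediff termK (fun x => (D314 x).Touches))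
    (hS314 : RWSumFactorYieldsSupL2 geo9Y (bg9Y (Matrix (Fin N) (Fin N) ℂ) (specialUnitaryUnits (Fin N))) Ediff termK (fun x => ((opsYOfLetters N θ.toStage3Params Mstar 𝔏 𝔈) x).Kdiff) OmKY)
    (hH314 : RWSumFactorYieldsHolder geo9Y (bg9Y (Matrix (Fin N) (Fin N) ℂ) (specialUnitaryUnits (Fin N))) Ediff termK (fun x => ((opsYOfLetters N θ.toStage3Params Mstar 𝔏 𝔈) x).Kdiff) OmKY)
    -- row 24 (seat n06-m): the letters of Theorem 3.15, the reading of `Ck`, the locality, the two pinned clauses under the printed prefix, the slot implications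
    {𝔸5 : Type} [NormedRing 𝔸5] {P5 W5 : MemberY θ.d₆ θ.ℓ₆ θ.hd' θ.hL' θ.b₀ θ.b₁ Mstar → Type} [∀ x, Fintype (P5 x)]
    (𝔬315 : ∀ x : MemberY θ.d₆ θ.ℓ₆ θ.hd' θ.hL' θ.b₀ θ.b₁ Mstar, Ops315 (geo9Y x) (bg9Y (Matrix (Fin N) (Fin N) ℂ) (specialUnitaryUnits (Fin N)) x) 𝔸5 (P5 x) (W5 x)) {K5 r5 m5 a5 δ5 B5 : ℝ}
    (hK5 : 0 < K5) (hm5 : 0 < m5) (ha5 : 0 < a5) (hδ5 : 0 < δ5) (hB5 : 0 < B5)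
    (hR5 : ∀ x : MemberY θ.d₆ θ.ℓ₆ θ.hd' θ.hL' θ.b₀ θ.b₁ Mstar, Reads315 (𝔬315 x) ((opsYOfLetters N θ.toStage3Params Mstar 𝔏 𝔈) x).Ck (inΛY x) K5) (hS5 : ∀ x : MemberY θ.d₆ θ.ℓ₆ θ.hd' θ.hL' θ.b₀ θ.b₁ Mstar, Static315 (𝔬315 x) (unitDistY x) r5 m5)
    (h315 : ∀ (x : MemberY θ.d₆ θ.ℓ₆ θ.hd' θ.hL' θ.b₀ θ.b₁ Mstar) (α₀ : ℝ), 0 < α₀ → (geo9Y x).M * α₀ ≤ a5 →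
      ∀ U : (bg9Y (Matrix (Fin N) (Fin N) ℂ) (specialUnitaryUnits (Fin N)) x).Cfg, (bg9Y (Matrix (Fin N) (Fin N) ℂ) (specialUnitaryUnits (Fin N)) x).Reg335 c35Y α₀ U → (bg9Y (Matrix (Fin N) (Fin N) ℂ) (specialUnitaryUnits (Fin N)) x).Reg336 c35Y α₀ U →
        GivenBy3185OfOps (𝔬315 x) U ∧ HasRWExpCOfOps (𝔬315 x) (unitDistY x) B5 U δ5)
    (hG315 : ∀ (x : MemberY θ.d₆ θ.ℓ₆ θ.hd' θ.hL' θ.b₀ θ.b₁ Mstar) (U : (bg9Y (Matrix (Fin N) (Fin N) ℂ) (specialUnitaryUnits (Fin N)) x).Cfg), GivenBy3185OfOps (𝔬315 x) U → ((opsYOfLetters N θ.toStage3Params Mstar 𝔏 𝔈) x).GivenBy3185 U)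
    (hH315 : ∀ (x : MemberY θ.d₆ θ.ℓ₆ θ.hd' θ.hL' θ.b₀ θ.b₁ Mstar) (U : (bg9Y (Matrix (Fin N) (Fin N) ℂ) (specialUnitaryUnits (Fin N)) x).Cfg) (δ' : ℝ), HasRWExpCOfOps (𝔬315 x) (unitDistY x) B5 U δ' → ((opsYOfLetters N θ.toStage3Params Mstar 𝔏 𝔈) x).HasRWExpC U δ')
    -- in place of `t314`: (γ) and (β) of sequel III
    (r : ℝ)
    (hgeo : ∀ (x : MemberY θ.d₆ θ.ℓ₆ θ.hd' θ.hL' θ.b₀ θ.b₁ Mstar) (y y' : (geo9Y x).Site), ¬ (OmKY x y ∧ OmKY x y') →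
      dOmegaY x y y' ≤ (geo9Y x).dist y y' + r)
    (hplain : ∃ M₁ δ₁ a₁ B₁ : ℝ, 0 < M₁ ∧ 0 < δ₁ ∧ 0 < a₁ ∧ 0 < B₁ ∧
      ∀ x : MemberY θ.d₆ θ.ℓ₆ θ.hd' θ.hL' θ.b₀ θ.b₁ Mstar, M₁ ≤ (geo9Y x).M → ∀ α₀ : ℝ, 0 < α₀ → (geo9Y x).M * α₀ ≤ a₁ →
        ∀ U : (bg9Y (Matrix (Fin N) (Fin N) ℂ) (specialUnitaryUnits (Fin N)) x).Cfg,
          (bg9Y (Matrix (Fin N) (Fin N) ℂ) (specialUnitaryUnits (Fin N)) x).Reg335 c35Y α₀ U → IneqSupF ((opsYOfLetters N θ.toStage3Params Mstar 𝔏 𝔈) x).Kdiff B₁ δ₁ (fun _ => True) (fun _ _ => 1) U)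
    -- the remaining printed leaves, verbatim
    (t312 : B9.Thm312Printed (θ.d₆ + 1) c35Y geo9Y (bg9Y (Matrix (Fin N) (Fin N) ℂ) (specialUnitaryUnits (Fin N))) (fun x => ((opsYOfLetters N θ.toStage3Params Mstar 𝔏 𝔈) x).GD)
      (fun x => ((opsYOfLetters N θ.toStage3Params Mstar 𝔏 𝔈) x).G₁) (fun x => ((opsYOfLetters N θ.toStage3Params Mstar 𝔏 𝔈) x).H) (fun x => ((opsYOfLetters N θ.toStage3Params Mstar 𝔏 𝔈) x).H₁) (fun x => ((opsYOfLetters N θ.toStage3Params Mstar 𝔏 𝔈) x).HasRWExp) (fun x => ((opsYOfLetters N θ.toStage3Params Mstar 𝔏 𝔈) x).HasRWExpH)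
      (fun x => ((opsYOfLetters N θ.toStage3Params Mstar 𝔏 𝔈) x).PosDefK))
    (t313 : B9.Thm313Printed c35Y geo9Y (bg9Y (Matrix (Fin N) (Fin N) ℂ) (specialUnitaryUnits (Fin N))) (fun x => ((opsYOfLetters N θ.toStage3Params Mstar 𝔏 𝔈) x).GG)
      (fun x => ((opsYOfLetters N θ.toStage3Params Mstar 𝔏 𝔈) x).HasRWExp) (fun x => ((opsYOfLetters N θ.toStage3Params Mstar 𝔏 𝔈) x).PosDefK))
    -- in place of `s349`: n06-i's (3.25) dictionary (row 25; the record-geometry facts are n06-i's theorems `B9GeoLemma21KLevelV1.*`)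
    (hdict : ∀ x : MemberY θ.d₆ θ.ℓ₆ θ.hd' θ.hL' θ.b₀ θ.b₁ Mstar, Dict349 ((opsYOfLetters N θ.toStage3Params Mstar 𝔏 𝔈) x).Gp ((opsYOfLetters N θ.toStage3Params Mstar 𝔏 𝔈) x).Cinv ((opsYOfLetters N θ.toStage3Params Mstar 𝔏 𝔈) x).P349)
    (P : B12.RunParams) : Dag.B9_main (leavesP w P) := by
  have hL1 : (1 : ℝ) ≤ ((θ.ℓ₆ + 1 : ℕ) : ℝ) := by exact_mod_cast Nat.succ_le_succ (Nat.zero_le _)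
  have hη : ∀ x : MemberY θ.d₆ θ.ℓ₆ θ.hd' θ.hL' θ.b₀ θ.b₁ Mstar, 0 < (geo9Y x).eta := fun x => (distOK_geo9Y x).eta_pos
  -- the two (3.47) sub-leaves from the (3.42) leaves ON the summand + glob-readings + Lemma 2.1
  have hGpG : AtOneGlobOn geo9Y (bg9Y (Matrix (Fin N) (Fin N) ℂ) (specialUnitaryUnits (Fin N))) (fun x => ((opsYOfLetters N θ.toStage3Params Mstar 𝔏 𝔈) x).Gp) (fun _ lam => ¬ (lam.isRight = true)) :=
    atOneGlobOn_of_atOneEOn (fun x => modelSignsOn_geo9K x.toKIdx) hRGp d21 (L := ((θ.ℓ₆ + 1 : ℕ) : ℝ)) hL1 (fun _ => hL1) (fun _ => le_rfl)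
      hη hL21 hEGp
  have hGAG : AtOneGlobOn geo9Y (bg9Y (Matrix (Fin N) (Fin N) ℂ) (specialUnitaryUnits (Fin N))) (fun x => ((opsYOfLetters N θ.toStage3Params Mstar 𝔏 𝔈) x).GA) (fun _ lam => lam.isRight = true) :=
    atOneGlobOn_of_atOneEOn (fun x => modelSignsOn_geo9K x.toKIdx) hRGA d21 (L := ((θ.ℓ₆ + 1 : ℕ) : ℝ)) hL1 (fun _ => hL1) (fun _ => le_rfl)
      hη hL21 hEGA
  -- rows 17, 18 (+ the G-half of `hsum`), 23, 24 from the per-row lemmas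
  have t311 := t311_of_pin θ.toStage3Params Mstar (opsYOfLetters N θ.toStage3Params Mstar 𝔏 𝔈) 𝔬311 θ311 a311 M311 ha311 hM311 h311 hPD
  have t310 := t310_of_pin θ.toStage3Params Mstar (opsYOfLetters N θ.toStage3Params Mstar 𝔏 𝔈) 𝔬310 rd310 R310 H310 κ310 d3 α3 ρ3 N3 N3' NF3 Cℓ3 K3 θ3 B3 δ3 a3 M3 ML3 hα3 hα3' hN3 hN3' hNF3 hCℓ3
    hK3 hθ3 hB3 hδ3 ha3 hM3 hst3 hκ3 hrd3 hloc3 h261_3 h36_3 hE310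
  have h310 := hsumG_of_pin θ.toStage3Params Mstar (opsYOfLetters N θ.toStage3Params Mstar 𝔏 𝔈) 𝔬310 rd310 R310 H310 d3 hN3 hN3' hCℓ3 hK3 hB3 hE310 ev3 evY3 hcoA0 hcoA1 hcoA2 hcoA3 hCB3 hδ₁le3
    hrestA
  have t314loc := t314loc_of_leaves θ.toStage3Params Mstar (opsYOfLetters N θ.toStage3Params Mstar 𝔏 𝔈) D314 L314 r314 hr314 hA314 hS314 hH314
  have t315 := t315_of_pins θ.toStage3Params Mstar (opsYOfLetters N θ.toStage3Params Mstar 𝔏 𝔈) 𝔬315 hK5 hm5 ha5 hδ5 hB5 hR5 hS5 h315 hG315 hH315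
  -- rows 4–8 (the `GAOfOps` pin), 11–12 (residual-at-one faces), 15–16 and 26 (per-row lemmas) — the rows of the intermediate link `…Batch2`
  -- rows 1–8 at the instance (n06-f, n06-g) and the null readings off the summands (`rfl`)
  have hGp_e := hGp_e_opsYOfLetters N θ.toStage3Params Mstar 𝔏 𝔈
  have hGp_h1 := hGp_h1_opsYOfLetters N θ.toStage3Params Mstar 𝔏 𝔈
  have hC := hC_opsYOfLetters N θ.toStage3Params Mstar 𝔏 𝔈
  have hGA_e := hGA_e_opsYOfLetters N θ.toStage3Params Mstar 𝔏 𝔈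
  have hGA_h1 := hGA_h1_opsYOfLetters N θ.toStage3Params Mstar 𝔏 𝔈
  have hGA_e4 := hGA_e4_opsYOfLetters N θ.toStage3Params Mstar 𝔏 𝔈
  have hGA_h2 := hGA_h2_opsYOfLetters N θ.toStage3Params Mstar 𝔏 𝔈
  have hGA_l2 := hGA_l2_opsYOfLetters N θ.toStage3Params Mstar 𝔏 𝔈
  have hnullL2 : ∀ (x : MemberY θ.d₆ θ.ℓ₆ θ.hd' θ.hL' θ.b₀ θ.b₁ Mstar) (n : Fin 6) (lam : (geo9Y x).Loc) (h : (geo9Y x).Cut), lam.isRight = true →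
      ((opsYOfLetters N θ.toStage3Params Mstar 𝔏 𝔈) x).Gp.l2 n (bg9Y (Matrix (Fin N) (Fin N) ℂ) (specialUnitaryUnits (Fin N)) x).one lam h ≤ 0 := fun x n lam h hlam => by
    cases lam with
    | inl f => exact absurd hlam (by simp)
    | inr J => cases h <;> exact le_of_eq rfl
  have hnullG : ∀ (x : MemberY θ.d₆ θ.ℓ₆ θ.hd' θ.hL' θ.b₀ θ.b₁ Mstar) (n : Fin 4) (lam : (geo9Y x).Loc) (γ : ℝ), lam.isRight = true →
      ((opsYOfLetters N θ.toStage3Params Mstar 𝔏 𝔈) x).Gp.glob n (bg9Y (Matrix (Fin N) (Fin N) ℂ) (specialUnitaryUnits (Fin N)) x).one lam γ ≤ 0 := fun x n lam γ hlam => by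
    cases lam with
    | inl f => exact absurd hlam (by simp)
    | inr J => exact le_of_eq rfl
  have hnullE4 : ∀ (x : MemberY θ.d₆ θ.ℓ₆ θ.hd' θ.hL' θ.b₀ θ.b₁ Mstar) (lam : (geo9Y x).Loc) (y : (geo9Y x).Site), lam.isRight = true →
      ((opsYOfLetters N θ.toStage3Params Mstar 𝔏 𝔈) x).Gp.e4 (bg9Y (Matrix (Fin N) (Fin N) ℂ) (specialUnitaryUnits (Fin N)) x).one lam y ≤ 0 := fun x lam y hlam => by
    cases lam with
    | inl f => exact absurd hlam (by simp)
    | inr J => exact le_of_eq rfl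
  have hnullH2 : ∀ (x : MemberY θ.d₆ θ.ℓ₆ θ.hd' θ.hL' θ.b₀ θ.b₁ Mstar) (lam : (geo9Y x).Loc) (b : ℝ) (ζ : (geo9Y x).Cut), lam.isRight = true →
      ((opsYOfLetters N θ.toStage3Params Mstar 𝔏 𝔈) x).Gp.h2 (bg9Y (Matrix (Fin N) (Fin N) ℂ) (specialUnitaryUnits (Fin N)) x).one lam b ζ ≤ 0 := fun x lam b ζ hlam => by
    cases lam with
    | inl f => exact absurd hlam (by simp)
    | inr J => cases ζ <;> exact le_of_eq rfl
  have hGp := hGp_of_blocksOn_of_null (opsYOfLetters N θ.toStage3Params Mstar 𝔏 𝔈) hGp_h1 hnullL2 hnullG hnullE4 hnullH2 hGpL2 hGpG hGpH1 hGpE4 hGpH2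
  have hGA := hGA_of_globOn_of_null (opsYOfLetters N θ.toStage3Params Mstar 𝔏 𝔈) (hnullGA_opsYOfLetters N θ.toStage3Params Mstar 𝔏 𝔈) hGAG
  have t39 := t39_of_pin θ.toStage3Params Mstar (opsYOfLetters N θ.toStage3Params Mstar 𝔏 𝔈) 𝔬39 rd39 R39 H39 α39 α' r39 δ39 θ39 B39 N39 a39 M39 ML39 h39α h39α1 hα' hr39 hrδ39 hδ39 hθ39 hB39 hN39
    ha39 hM39 hst39 hloc39 h261_39 h39 hEK39
  have hksum := hksum_of_pin θ.toStage3Params Mstar (opsYOfLetters N θ.toStage3Params Mstar 𝔏 𝔈) 𝔬39 rd39 hEK39 hB₁39 hδ₁39 hrdC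
  have s3132 := s3132_of_inputs θ.toStage3Params Mstar (opsYOfLetters N θ.toStage3Params Mstar 𝔏 𝔈) hCT hCT₁ hN32 hN32₁ hA32 hwt
  exact b9_main_of_up_view₁₁B10YZW_of_obligations_W38T314SectBnHgEHS349supplied θ hθ Mstar (opsYOfLetters N θ.toStage3Params Mstar 𝔏 𝔈) ζ lamW w hup hGp_e hGp_h1 hC hGA_e hGA_h1 hGA_e4 hGA_h2 hGA_l2 hGp
    hGA hA hEp hLp hGlp hH1p hE4p hH2p hK hEa hLa hGla hH1a hE4a hH2a 𝔬 rd R H κ d α ρ Nc N' Cℓ K θ₀ B₀ δ₀ a₁ M₁ ML hα hα2 hN hN' hCℓ hK0 hθ₀ hB₀ hδ₀ ha₁ hM₁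
    hst hκ hrd hloc h261 h36 hE38 evY hco0 hco1 hco2 hco3 hB₁ hδ₁ hCB hδ₁le hrest h310 r hgeo hplain t39 t310 hksum t311 t312 t313 t315 hdict (fun x => distOK_geo9Y x)
    one_pos levelGap_geo9Y_one rowSum261_geo9Y s3132 t314loc P

end Pointed

end Summit.QuantumFields.YangMills.BalabanUVNodes.N06AtOpsYOfLetters

end
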